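import Summits.QuantumFields.GaugeBoot.PlanarRelaxationResolved
import Summits.QuantumFields.GaugeBoot.BootstrapArchimedean
import HarnessLib

/-!
# The orientation-resolved relaxation block is a CUT of the word-truncated bootstrap: it holds for every functional non-negative on the squares of a test module containing the loops' real and imaginary parts (gauge-boot, large-`N` supplement 15, rider)

HONEST FRAMING (cell `pub-gaugeboot`, page 1 of every file): the venture produces certified bounds
on lattice expectations at stated coupling, gauge group, dimension and torus size; NOT a mass gap,
NOT a continuum limit, NOT a string tension; NOT large `N` unless marked CONDITIONAL; NOT
Yang–Mills-summit-bearing (barriers `FixedCouplingUltralocality`, `PerturbativeInvisibility`).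
Algebra only; this file certifies no number.

## Content

Supplement 15 (`PlanarRelaxationResolved`) showed that Kazakov–Zheng's relaxation block, read through the
reversed second loop, is `φ((m₀ + Σ m_A a_A)²) + φ((Σ m_A b_A)²)` for a linear functional `φ` with `φ 1 = 1`
(`shorPairing_apply_conj_eq`).  Hence (item (lxvi), abstract form):

* ★★ `isRelaxationFeasible_apply_conj_of_submodule` — for ANY linear `φ` with `φ 1 = 1` which is
  non-negative on the squares `v²`, `v ∈ V`, of a submodule `V ∋ 1` containing the "real parts" `a_A` and
  "imaginary parts" `b_A` of the loops: the resolved block `[[1, Wᵀ], [W, Q]]`, `W_A = φ a_A`,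
  `Q_{AB} = φ(a_A a_B + b_A b_B)`, is feasible — the block is a CONSEQUENCE of square-positivity on `V`,
  i.e. a valid CUT that adds nothing to a bootstrap whose test module already contains the `a_A, b_A`;
* ★★ `isRelaxationFeasible_of_isBootstrapFeasible_wordTruncation` — in particular for every feasible point
  `φ` of the lane's word-truncated bootstrap at level `n` (`IsBootstrapFeasible r k S β (wordTruncation r n) φ`)
  and loops whose real/imaginary trace polynomials `a_A, b_A` are level-`n` test functions;
  `isRelaxationFeasible_of_sq_nonneg` (the untruncated form: `φ` non-negative on all squares).

NOT here (still open, the concrete half of (lxvi)): that the real/imaginary parts of the trace of a word of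
length `≤ n` in the link variables ARE level-`n` test functions (`∈ wordTruncation r n`) — the lane types
`wordTruncation` by products of matrix-entry generators, and the trace-polynomial bookkeeping is not in the
tree.  [folklore] (Kazakov–Zheng arXiv:2404.16925 §3.1: multi-trace positivity).
-/

noncomputable section

open scoped BigOperators
open Literature.MathematicalPhysics.QuantumFieldTheory (LatticeRep)

namespace Summit.QuantumFields.GaugeBoot

variable {ι : Type*} [Fintype ι]

/-! ## Abstract form: square-positivity on a test module implies the resolved block -/

section Abstract

variable {R : Type*} [CommRing R] [Algebra ℝ R]

/-- ★★ **The resolved relaxation block is a cut of square-positivity on a test module.**  `φ` linear with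
`φ 1 = 1` and `φ (v * v) ≥ 0` for all `v` in a submodule `V` containing `1`, the `a_A` and the `b_A`:
then `[[1, Wᵀ], [W, Q]] ⪰ 0` (in factor form) for `W_A = φ a_A`, `Q_{AB} = φ(a_A a_B + b_A b_B)`. [folklore] -/
theorem isRelaxationFeasible_apply_conj_of_submodule (φ : R →ₗ[ℝ] ℝ) (h1 : φ 1 = 1) (V : Submodule ℝ R)
    (hone : (1 : R) ∈ V) (hsq : ∀ v ∈ V, 0 ≤ φ (v * v)) (a b : ι → R) (ha : ∀ A, a A ∈ V) (hb : ∀ A, b A ∈ V) :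
    IsRelaxationFeasible (fun A => φ (a A)) (fun A B => φ (a A * a B + b A * b B)) := by
  intro m₀ m
  refine shorPairing_apply_conj_nonneg φ h1 m₀ m a b ?_ ?_
  · rw [sq]
    refine hsq _ (V.add_mem ?_ (V.sum_mem fun A _ => V.smul_mem _ (ha A)))
    rw [Algebra.algebraMap_eq_smul_one]
    exact V.smul_mem _ hone
  · rw [sq]
    exact hsq _ (V.sum_mem fun A _ => V.smul_mem _ (hb A))

/-- **Untruncated form**: `φ` non-negative on ALL squares (e.g. any state) ⇒ the resolved block holds. [folklore] -/
theorem isRelaxationFeasible_of_sq_nonneg (φ : R →ₗ[ℝ] ℝ) (h1 : φ 1 = 1) (hsq : ∀ v : R, 0 ≤ φ (v * v)) (a b : ι → R) :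
    IsRelaxationFeasible (fun A => φ (a A)) (fun A B => φ (a A * a B + b A * b B)) :=
  isRelaxationFeasible_apply_conj_of_submodule φ h1 ⊤ Submodule.mem_top (fun v _ => hsq v) a b (fun _ => Submodule.mem_top)
    fun _ => Submodule.mem_top

end Abstract

/-! ## The word-truncated bootstrap of the lane -/

section WordTruncation

variable {κ : Type*} [DecidableEq κ] {G : Type*} [Group G] [TopologicalSpace G] (r : LatticeRep G) {K : Type*}
  {k : K → ℝ → G} {S : κ → (κ → G) → ℝ} {β : ℝ}

/-- ★★ **For every feasible point of the word-truncated bootstrap at level `n`** (normalised, non-negative on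
the squares of level-`n` test functions, Schwinger–Dyson identities — the last are not even used) **and loops
whose real / imaginary trace polynomials are level-`n` test functions, the orientation-resolved relaxation
block is feasible**: KZ's relaxation, correctly wired, is implied by the positivity the finite-`N` SDP already
has. [folklore] -/
theorem isRelaxationFeasible_of_isBootstrapFeasible_wordTruncation {n : ℕ} {φ : C(κ → G, ℝ) →ₗ[ℝ] ℝ}
    (hφ : IsBootstrapFeasible r k S β (wordTruncation (ι := κ) r n) φ) (a b : ι → C(κ → G, ℝ))
    (ha : ∀ A, a A ∈ wordTruncation (ι := κ) r n) (hb : ∀ A, b A ∈ wordTruncation (ι := κ) r n) :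
    IsRelaxationFeasible (fun A => φ (a A)) (fun A B => φ (a A * a B + b A * b B)) :=
  isRelaxationFeasible_apply_conj_of_submodule φ hφ.1 (Submodule.span ℝ (wordsUpTo (ι := κ) r n))
    (one_mem_wordTruncation r n) (fun v hv => hφ.2.1 v hv) a b ha hb

/-- The same with the test module as an explicit hypothesis set `V` (any level scheme): normalisation and
square-positivity on a submodule `V ∋ 1, a_A, b_A` suffice. [folklore] -/
theorem isRelaxationFeasible_of_isBootstrapFeasible {V : Submodule ℝ C(κ → G, ℝ)} {φ : C(κ → G, ℝ) →ₗ[ℝ] ℝ}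
    (hφ : IsBootstrapFeasible r k S β (V : Set C(κ → G, ℝ)) φ) (hone : (1 : C(κ → G, ℝ)) ∈ V) (a b : ι → C(κ → G, ℝ))
    (ha : ∀ A, a A ∈ V) (hb : ∀ A, b A ∈ V) :
    IsRelaxationFeasible (fun A => φ (a A)) (fun A B => φ (a A * a B + b A * b B)) :=
  isRelaxationFeasible_apply_conj_of_submodule φ hφ.1 V hone (fun v hv => hφ.2.1 v hv) a b ha hb

end WordTruncation

end Summit.QuantumFields.GaugeBoot

end
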